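/-
Copyright (c) 2026 the pub-hodgecm-mathlib formalisation cell (harness21).  Prover seat hodgecm-mathlib-K2E3-p23 (g9), Track B «K2-LIT» ∕ hLiu418 #184♮,
Road I v3, unit U5 «THE CLOSE»: FACE-D₀ row `hfin₂` — the RANK-ONE twin of ★ p863332 `K2LiuFirstTermLineLiftRankRowModelConj` in the GLOBAL-INTERTWINER form:
«a NON-ZERO `S`-th coefficient of a line lift puts the local index `βloc` on the moment map of the line model».  THEOREMS ONLY.
-/
import Summits.HodgeConjecture.HodgeConjecture.Theorems.K2LiuFirstTermLineLiftRankRow   -- ★ p862821 (B4): `fourierCoeffDelta_thetaLift_pairRep_unipDelta`, `fourierCoeffDelta_thetaLift_eq_at_one`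
import Summits.HodgeConjecture.HodgeConjecture.Theorems.K2LiuRankOneLineGram           -- ★ U2c file 1 §1′: `exists_lineGram_eq_of_functional_ne_zero` («U2c-fin», model form)
import HarnessLib

/-!
# K2_Liu road (hLiu418 = stmt-HodgeConjecture-24832), Road I v3, U5 «THE CLOSE», FACE-D₀ row `hfin₂`, GLOBAL-INTERTWINER FORM:
# a non-zero `S`-th Fourier coefficient of a doubled line theta lift forces `βloc = a • σ(y) ⊗ y` in the σ-explicit line model

Cell `pub/hodgecm-mathlib` (D-0151), Track B, build stream 29; helper lane `--supports stmt-HodgeConjecture-24832 --as helper`, count-neutral.  RANK-ONE companion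
of ★ p863332 `K2LiuFirstTermLineLiftRankRowModelConj` (whose head is the case `det βloc ≠ 0`: the coefficient VANISHES).  Same letters (★ p863332 :67–:125 verbatim)
EXCEPT `hdet` (dropped: here `βloc` is the local index of a rank-one hermitian `β`), same `Tg`∕`hκ` global-intertwiner form, and the conclusion is ★ U2c's
moment-map statement instead of ★ U2a's vanishing:
* **`fourierCoeffDelta_thetaLift_eq_zero_of_forall_lineGram_ne`** — if `βloc` is OFF the moment map (`∀ x, a • σ(v x) ⊗ v x ≠ βloc`) then `∀ Φ, cf_S(Θ̃_Φ(fw))(1) = 0`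
  (★ p863332's proof word for word, with ★ `exists_lineGram_eq_of_functional_ne_zero` closing the semi-invariant functional `φ ↦ Λ^κ(Φ_∞ ⊗ φ)`);
* **`exists_lineGram_of_fourierCoeffDelta_thetaLift_ne_zero_of_finLineModel_conj`** — the contrapositive, at ANY `h ∈ H(𝔸)` (★ `fourierCoeffDelta_thetaLift_eq_at_one`):
  `cf_S(Θ̃_Φ(fw))(h) ≠ 0 → ∃ x, a • σ(v x) ⊗ v x = βloc` — «U2c-fin» for the theta side: a surviving index is a GRAM MATRIX OF THE LINE MODEL at the place.
Downstream (K2E3-p23 `K2LiuFirstTermLineLiftRankOneRowAtPlace`): at `R := L ⊗ L⁺_v`, `βloc = β ⊗ 1` for `S = dict β`, `β = b • σ(u) ⊗ u` rank one, ★ U2c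
`eq_mul_conj_mul_self_of_smul_vecMulVec_eq` + `locF_eq_of_eq_mul_conjLocal` turn the conclusion into the line-class letter `locF b v = locF a₀ v` of ★ p862803's `hfin₂`.
LETTERS left BY VALUE after this file: `Tg`∕`hκ` (★ p864051 `exists_Tg_pairRep_line_lineCayley_of_fst`), the σ-explicit line model's letters (★ p864330's organ at `v`),
the linear readings `Bl`∕`cfS` (★ (t)∕(c) instances).
No definition, no instance, no notation, no named-fact hypothesis, no `sorry`; axioms ⊆ {propext, Classical.choice, Quot.sound}.  HONEST LABEL: HC_CM is proved only modulo
the 7 printed citations (2 remaining named inputs: hLiu418 = stmt-HodgeConjecture-24832, h413 = stmt-HodgeConjecture-24833) until rung 0 closes; this file moves no counter;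
`hfin₂` NOT discharged here (the archimedean sign letter `hsign₂` and the place instance are separate).

References: [Rallis1984] S. Rallis, Compositio Math. 51 (1984) §4; [KudlaRallis1994] S. Kudla, S. Rallis, Ann. of Math. 140 (1994) §3 (support of the Fourier
coefficients of theta lifts on represented indices); [Weil1964] A. Weil, Acta Math. 111 (1964) Chap. I n° 13 p. 160, Chap. III n° 37–38 pp. 188–190, n° 41 Thm 6 p. 193;
[Kudla1994] S. Kudla, Israel J. Math. 87 (1994) §3; [MoeglinWaldspurger1995] I.2.6; [Liu2021] Y. Liu, Camb. J. Math. 9 (2021) Def. 4.11–4.12, App. B Prop. B.8 p. 104.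
-/

set_option autoImplicit false
set_option linter.dupNamespace false
-- statements over the adelic dual-pair carriers elaborate to very large types; elaborate sequentially (as in ★ `K2LiuLineThetaFunctionalOfRecord`)
set_option Elab.async false

noncomputable section

open NumberField NumberField.mixedEmbedding MeasureTheory IsDedekindDomain
open scoped Matrix ComplexOrder ENNReal TensorProduct SchwartzMap Classical  -- `Classical`: the `Fintype` of real ∕ complex places inside `mixedSpace (L⁺)` (as ★ p862586)

namespace Summit.HodgeConjecture.HodgeConjecture.Cruxes.HLiu418.K2LiuFirstTermLineLiftRankOneRowModelConj

open Literature.NumberTheory.Automorphic Literature.NumberTheory.Automorphic.UnitaryGroup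
open Literature.NumberTheory.Automorphic.IdeleClassGroup
open Literature.NumberTheory.Automorphic.Liu2021
open Literature.NumberTheory.Automorphic.Liu2021.Def411WeilCarriers
open Literature.NumberTheory.Automorphic.Liu2021.Def411WeilCarriersDoubling
open Literature.NumberTheory.GelbartRogawski1991 Literature.NumberTheory.GelbartRogawski1991.UnitaryDualPair
open Literature.NumberTheory.GelbartRogawski1991.GRConstruction
open Literature.NumberTheory.GaloisRepresentations
open Literature.NumberTheory.Weil1964
open Literature.RepresentationTheory Literature.RepresentationTheory.Liu2021
open Literature.NumberTheory.K2Lit.DoubledLineTheta Literature.NumberTheory.K2Lit.SiegelDoubled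
open Literature.MeasureTheory.Group
open Summit.HodgeConjecture.HodgeConjecture.Cruxes.HLiu418.K2LiuSiegelUnipotentFourierDefs
open Summit.HodgeConjecture.HodgeConjecture.Cruxes.HLiu418.K2LiuSiegelUnipotentCharacters
open Summit.HodgeConjecture.HodgeConjecture.Cruxes.HLiu418.K2LiuUnipotentCoveringWeight
open Summit.HodgeConjecture.HodgeConjecture.Cruxes.HLiu418.K2LiuFirstTermLineLiftRankRow
open Summit.HodgeConjecture.HodgeConjecture.Cruxes.HLiu418.K2LiuRankOneLineGram (exists_lineGram_eq_of_functional_ne_zero)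

variable (L : Type) [Field L] [NumberField L] [IsCMField L]
variable {N n : ℕ} (e : Fin N × Fin 1 ≃ Fin n)
  (dV : Fin N → L) (hdV : ∀ i, IsCMField.complexConj L (dV i) = dV i)
  (dW : Fin 1 → L) (hdW : ∀ i, IsCMField.complexConj L (dW i) = dW i)
  {n'' : ℕ} (e₁ : Fin (n + n) × Fin 1 ≃ Fin n'')
  (hdV0 : ∀ i, dV i ≠ 0) (hdW0 : ∀ i, dW i ≠ 0)
  (lam : IdeleClassGroup L →ₜ* Circle) (hlam : IsConjugateSymplectic L lam) (a' : (Fp L)ˣ)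
  (hρ : HasThetaMajorants fun
      (p : ↥(UnitaryGroup.adelic (Fp L) L (IsCMField.complexConj L) (n + n) (Matrix.diagonal (dD L e dV hdV dW hdW))) ×
        ↥(UnitaryGroup.adelic (Fp L) L (IsCMField.complexConj L) 1 (JW (Fp L) L a')))
      (Φ : piSchwartzBruhat (Fp L) (Fin n'')) =>
        pairRep (Fp L) L (IsCMField.complexConj L) (n + n) 1 e₁ (Matrix.diagonal (dD L e dV hdV dW hdW)) (JW (Fp L) L a')
          (chiSplittingLine L e₁ (dD L e dV hdV dW hdW) (dD_conj L e dV hdV dW hdW) (dD_ne_zero L e dV hdV dW hdW hdV0 hdW0)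
            (toHeckeCharacter L lam) (isUnitary_toHeckeCharacter L lam)
            ((isOscillatorChar_toHeckeCharacter_iff lam).mpr hlam) (TW (Fp L) a')
            (isUnit_det_TW (Fp L) a') (JW (Fp L) L a') (JW_eq (Fp L) L a'))
          p Φ)
  [MeasurableSpace (↥(UnitaryGroup.adelic (Fp L) L (IsCMField.complexConj L) 1 (JW (Fp L) L a')) ⧸
    (UnitaryGroup.toAdelic (Fp L) L (IsCMField.complexConj L) 1 (JW (Fp L) L a')).range)]
  [BorelSpace (↥(UnitaryGroup.adelic (Fp L) L (IsCMField.complexConj L) 1 (JW (Fp L) L a')) ⧸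
    (UnitaryGroup.toAdelic (Fp L) L (IsCMField.complexConj L) 1 (JW (Fp L) L a')).range)]
  (μW : Measure (↥(UnitaryGroup.adelic (Fp L) L (IsCMField.complexConj L) 1 (JW (Fp L) L a')) ⧸
    (UnitaryGroup.toAdelic (Fp L) L (IsCMField.complexConj L) 1 (JW (Fp L) L a')).range)) [IsFiniteMeasure μW]
  (fw : C(↥(UnitaryGroup.adelic (Fp L) L (IsCMField.complexConj L) 1 (JW (Fp L) L a')) ⧸
    (UnitaryGroup.toAdelic (Fp L) L (IsCMField.complexConj L) 1 (JW (Fp L) L a')).range, ℂ))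
  [MeasurableSpace (unipDelta L e dV hdV dW hdW)] [BorelSpace (unipDelta L e dV hdV dW hdW)]
  (νN : Measure (unipDelta L e dV hdV dW hdW)) [νN.IsMulLeftInvariant]
  {βw : unipDelta L e dV hdV dW hdW → ℝ≥0∞} (hβ : IsCoveringWeight (unipDeltaRat L e dV hdV dW hdW) βw) (hβtop : ∫⁻ u, βw u ∂νN ≠ ∞)
  (S : Matrix (Fin n) (Fin n) L)

/-! ## The letters: linear readings of the lift and of the coefficient, and the σ-explicit line model on `𝒮(𝔸_f^{n″})` -/

variable
  -- (i) ★ (t): the lift as a linear map of `Φ`, and ★ (c): the coefficient as a linear map on a class `P ∋ Bl Φ`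
  (Bl : ↥(piSchwartzBruhat (Fp L) (Fin n'')) →ₗ[ℂ] (HA L e dV hdV dW hdW → ℂ))
  (hBl : ∀ (Φ : piSchwartzBruhat (Fp L) (Fin n'')) (h : HA L e dV hdV dW hdW),
    Bl Φ h = doubledLineThetaLift L e dV hdV dW hdW e₁ hdV0 hdW0 lam hlam a' hρ μW Φ fw h)
  (P : Submodule ℂ (HA L e dV hdV dW hdW → ℂ)) (hPB : ∀ Φ, Bl Φ ∈ P) (cfS : ↥P →ₗ[ℂ] (HA L e dV hdV dW hdW → ℂ))
  (hcf : ∀ (y : ↥P) (h : HA L e dV hdV dW hdW), cfS y h = fourierCoeffDelta L e dV hdV dW hdW νN βw S (y : HA L e dV hdV dW hdW → ℂ) h)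
  -- (ii) the σ-explicit line model at one finite place, on the finite-adelic Schwartz–Bruhat space (★ U2a §1′ binders verbatim)
  {R : Type*} [CommRing R] {F : Type*} [Field F] [Algebra F R]
  (σ : R →+* R) (hσ : ∀ x, σ (σ x) = x) (hσF : ∀ c : F, σ (algebraMap F R c) = algebraMap F R c)
  (π : Matrix (Fin 2) (Fin 2) R →ₗ[F] Matrix (Fin 2) (Fin 2) R →ₗ[F] F)
  (hπ : ∀ H : Matrix (Fin 2) (Fin 2) R, (H.map σ)ᵀ = H → H ≠ 0 → ∃ s : Matrix (Fin 2) (Fin 2) R, (s.map σ)ᵀ = s ∧ π s H ≠ 0)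
  (ψ : AddChar F Circle) (hψ : ∃ t : F, ((ψ t : Circle) : ℂ) ≠ 1)
  {Z : Type*} [Group Z] (ρf : Representation ℂ Z (FinSB (Fp L) (Fin n'')))
  (b : Z → Matrix (Fin 2) (Fin 2) R) (hb : ∀ s : Matrix (Fin 2) (Fin 2) R, (s.map σ)ᵀ = s → ∃ z, b z = s)
  (a : R) (ha : σ a = a) (v : (Fin n'' → FiniteAdeleRing (𝓞 (Fp L)) (Fp L)) → Fin 2 → R)
  (hu : ∀ z, IsLocallyConstant fun x => ((ψ (π (b z) (a • Matrix.vecMulVec (⇑σ ∘ v x) (v x))) : Circle) : ℂ))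
  (hρm : ∀ (z : Z) (φ : FinSB (Fp L) (Fin n'')),
    ((ρf z φ : FinSB (Fp L) (Fin n'')) : (Fin n'' → FiniteAdeleRing (𝓞 (Fp L)) (Fp L)) → ℂ) =
      (fun x => ((ψ (π (b z) (a • Matrix.vecMulVec (⇑σ ∘ v x) (v x))) : Circle) : ℂ)) * φ)
  -- the local index `βloc`: σ-hermitian, NO determinant condition (rank one downstream)
  (βloc : Matrix (Fin 2) (Fin 2) R) (hherm : (βloc.map σ)ᵀ = βloc)
  (χ : Z →* ℂˣ) (hχ : ∀ z, ((χ z : ℂˣ) : ℂ) = ((ψ (π (b z) βloc) : Circle) : ℂ))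
  -- (iii) the embedding `ι : Z → N_Δ(𝔸)` and the character match `χ = ψ_S ∘ ι` (the Weil∕model letter itself is `hκ` in the heads below)
  (ι : Z → unipDelta L e dV hdV dW hdW)
  (hχS : ∀ z : Z, ((χ z : ℂˣ) : ℂ) = (unipDeltaChar L e dV hdV dW hdW S (((ι z : unipDelta L e dV hdV dW hdW)) : HA L e dV hdV dW hdW) : ℂ))

include hBl hPB hcf hβ hβtop hσ hσF hπ hψ hb ha hu hρm hherm hχ hχS

set_option maxHeartbeats 1000000 in -- the statements carry the line datum's `pairRep` telescope (default RED, measured on ★ p863332's heads)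
/-- **`Λ_S ≡ 0` WHEN THE LOCAL INDEX IS OFF THE MOMENT MAP, GLOBAL-INTERTWINER FORM.**  For ANY linear automorphism `Tg` of `𝒮(𝔸^{n″})` in whose model every
`ι z` acts on pure tensors by the σ-explicit multiplier model `ρf z` in the finite slot (`hκ`; at the datum ★ p864051 `exists_Tg_pairRep_line_lineCayley_of_fst`):
if NO model vector has Gram matrix `βloc` (`hoff : ∀ x, a • σ(v x) ⊗ v x ≠ βloc`), the `S`-th Fourier coefficient of every doubled line theta lift vanishes at `1`.
Proof = ★ p863332's word for word (`Λ^κ := Λ_S ∘ Tg⁻¹`; `φ ↦ Λ^κ(Φ_∞ ⊗ φ)` is `(Z, χ)`-semi-invariant by `hκ` + ★ p862821 + `hχS`; pure tensors generate), with the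
semi-invariant functional killed by ★ U2c `exists_lineGram_eq_of_functional_ne_zero` + `hoff` in place of ★ U2a's `det βloc ≠ 0`.
[cite: Rallis1984, §4] [cite: KudlaRallis1994, §3] [cite: Weil1964, Chap. I n° 13, Chap. III n° 37–38] [cite: Kudla1994, §3] -/
theorem fourierCoeffDelta_thetaLift_eq_zero_of_forall_lineGram_ne
    (Tg : ↥(piSchwartzBruhat (Fp L) (Fin n'')) ≃ₗ[ℂ] ↥(piSchwartzBruhat (Fp L) (Fin n'')))
    (hκ : ∀ (z : Z) (Φinf : 𝓢((Fin n'' → mixedSpace (Fp L)), ℂ)) (φ : FinSB (Fp L) (Fin n'')),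
      Tg (pairRep (Fp L) L (IsCMField.complexConj L) (n + n) 1 e₁ (Matrix.diagonal (dD L e dV hdV dW hdW)) (JW (Fp L) L a')
          (chiSplittingLine L e₁ (dD L e dV hdV dW hdW) (dD_conj L e dV hdV dW hdW) (dD_ne_zero L e dV hdV dW hdW hdV0 hdW0)
            (toHeckeCharacter L lam) (isUnitary_toHeckeCharacter L lam)
            ((isOscillatorChar_toHeckeCharacter_iff lam).mpr hlam) (TW (Fp L) a')
            (isUnit_det_TW (Fp L) a') (JW (Fp L) L a') (JW_eq (Fp L) L a'))
          (toDiagA L e dV hdV dW hdW ((ι z : unipDelta L e dV hdV dW hdW) : HA L e dV hdV dW hdW), 1)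
          (Tg.symm (piSchwartzBruhatEquiv (Fp L) (Fin n'') (Φinf ⊗ₜ[ℂ] φ)))) =
        piSchwartzBruhatEquiv (Fp L) (Fin n'') (Φinf ⊗ₜ[ℂ] ρf z φ))
    (hoff : ∀ x, a • Matrix.vecMulVec (⇑σ ∘ v x) (v x) ≠ βloc)
    (Φ : piSchwartzBruhat (Fp L) (Fin n'')) :
    fourierCoeffDelta L e dV hdV dW hdW νN βw S (doubledLineThetaLift L e dV hdV dW hdW e₁ hdV0 hdW0 lam hlam a' hρ μW Φ fw) 1 = 0 := by
  -- the linear functional `Λ_S Φ := cfS ⟨Bl Φ, _⟩ 1` and its pointwise reading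
  let ΛS : ↥(piSchwartzBruhat (Fp L) (Fin n'')) →ₗ[ℂ] ℂ :=
    LinearMap.proj (1 : HA L e dV hdV dW hdW) ∘ₗ cfS ∘ₗ LinearMap.codRestrict P Bl hPB
  have hΛS : ∀ Ψ : piSchwartzBruhat (Fp L) (Fin n''),
      ΛS Ψ = fourierCoeffDelta L e dV hdV dW hdW νN βw S (doubledLineThetaLift L e dV hdV dW hdW e₁ hdV0 hdW0 lam hlam a' hρ μW Ψ fw) 1 := by
    intro Ψ
    have hBΨ : ((LinearMap.codRestrict P Bl hPB Ψ : ↥P) : HA L e dV hdV dW hdW → ℂ) =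
        doubledLineThetaLift L e dV hdV dW hdW e₁ hdV0 hdW0 lam hlam a' hρ μW Ψ fw := by
      rw [LinearMap.codRestrict_apply]
      exact funext (hBl Ψ)
    change cfS (LinearMap.codRestrict P Bl hPB Ψ) 1 = _
    rw [hcf, hBΨ]
  -- the transported functional `Λ^κ := Λ_S ∘ Tg⁻¹`
  let ΛK : ↥(piSchwartzBruhat (Fp L) (Fin n'')) →ₗ[ℂ] ℂ := ΛS ∘ₗ Tg.symm.toLinearMap
  have hΛK : ∀ Ψ, ΛK Ψ = ΛS (Tg.symm Ψ) := fun Ψ => rfl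
  -- for each archimedean vector: `φ ↦ Λ^κ(Φ_∞ ⊗ φ)` is `(Z, χ)`-semi-invariant for the multiplier model, hence `0` by ★ U2c + `hoff`
  have hfin : ∀ (Φinf : 𝓢((Fin n'' → mixedSpace (Fp L)), ℂ)) (φ : FinSB (Fp L) (Fin n'')),
      ΛK (piSchwartzBruhatEquiv (Fp L) (Fin n'') (Φinf ⊗ₜ[ℂ] φ)) = 0 := by
    intro Φinf φ
    let Λa : FinSB (Fp L) (Fin n'') →ₗ[ℂ] ℂ :=
      ΛK ∘ₗ (piSchwartzBruhatEquiv (Fp L) (Fin n'')).toLinearMap ∘ₗ TensorProduct.mk ℂ (𝓢((Fin n'' → mixedSpace (Fp L)), ℂ)) (FinSB (Fp L) (Fin n'')) Φinf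
    have hΛa : ∀ φ' : FinSB (Fp L) (Fin n''), Λa φ' = ΛK (piSchwartzBruhatEquiv (Fp L) (Fin n'') (Φinf ⊗ₜ[ℂ] φ')) := fun φ' => rfl
    have hsemi : ∀ (z : Z) (φ' : FinSB (Fp L) (Fin n'')), Λa (ρf z φ') = ((χ z : ℂˣ) : ℂ) • Λa φ' := by
      intro z φ'
      rw [hΛa, hΛa, ← hκ, hΛK, hΛK, LinearEquiv.symm_apply_apply, hΛS, hΛS]
      -- ★ p862821 quasi-invariance at the vector `Tg⁻¹ (Φ_∞ ⊗ φ′)`, which is itself a finite sum of pure tensors — apply it to EVERY vector: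
      have hq : ∀ Ψ : piSchwartzBruhat (Fp L) (Fin n''),
          fourierCoeffDelta L e dV hdV dW hdW νN βw S
              (doubledLineThetaLift L e dV hdV dW hdW e₁ hdV0 hdW0 lam hlam a' hρ μW
                (pairRep (Fp L) L (IsCMField.complexConj L) (n + n) 1 e₁ (Matrix.diagonal (dD L e dV hdV dW hdW)) (JW (Fp L) L a')
                  (chiSplittingLine L e₁ (dD L e dV hdV dW hdW) (dD_conj L e dV hdV dW hdW) (dD_ne_zero L e dV hdV dW hdW hdV0 hdW0)
                    (toHeckeCharacter L lam) (isUnitary_toHeckeCharacter L lam)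
                    ((isOscillatorChar_toHeckeCharacter_iff lam).mpr hlam) (TW (Fp L) a')
                    (isUnit_det_TW (Fp L) a') (JW (Fp L) L a') (JW_eq (Fp L) L a'))
                  (toDiagA L e dV hdV dW hdW ((ι z : unipDelta L e dV hdV dW hdW) : HA L e dV hdV dW hdW), 1) Ψ) fw) 1 =
            (unipDeltaChar L e dV hdV dW hdW S (((ι z : unipDelta L e dV hdV dW hdW)) : HA L e dV hdV dW hdW) : ℂ) *
              fourierCoeffDelta L e dV hdV dW hdW νN βw S (doubledLineThetaLift L e dV hdV dW hdW e₁ hdV0 hdW0 lam hlam a' hρ μW Ψ fw) 1 :=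
        fun Ψ => fourierCoeffDelta_thetaLift_pairRep_unipDelta L e dV hdV dW hdW e₁ hdV0 hdW0 lam hlam a' hρ μW fw νN βw S hβ hβtop Ψ (ι z)
      rw [hq, hχS, smul_eq_mul]
    -- RANK-ONE TWIST of ★ p863332: a NON-ZERO semi-invariant `Λa` would put `βloc` on the moment map (★ U2c, model form) — excluded by `hoff`
    have h0 : Λa = 0 := by
      by_contra hΛa0
      obtain ⟨x, hx⟩ :=
        exists_lineGram_eq_of_functional_ne_zero σ hσ hσF π hπ ψ hψ ρf b hb a ha v βloc hu hρm χ hχ hherm Λa hsemi hΛa0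
      exact hoff x hx
    rw [← hΛa, h0, LinearMap.zero_apply]
  -- pure tensors generate `𝒮(𝔸^{n″})`, so `Λ^κ = 0`
  have hall : ∀ t : 𝓢((Fin n'' → mixedSpace (Fp L)), ℂ) ⊗[ℂ] FinSB (Fp L) (Fin n''), ΛK (piSchwartzBruhatEquiv (Fp L) (Fin n'') t) = 0 := by
    intro t
    induction t using TensorProduct.induction_on with
    | zero => rw [map_zero, map_zero]
    | tmul x y => exact hfin x y
    | add x y hx hy => rw [map_add, map_add, hx, hy, add_zero]
  -- `Λ_S Φ = Λ^κ (Tg Φ)` and `Tg Φ` is the image of a tensor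
  have hback : ΛS Φ = ΛK (Tg Φ) := by rw [hΛK, LinearEquiv.symm_apply_apply]
  have hΦ : Tg Φ = piSchwartzBruhatEquiv (Fp L) (Fin n'') ((piSchwartzBruhatEquiv (Fp L) (Fin n'')).symm (Tg Φ)) :=
    ((piSchwartzBruhatEquiv (Fp L) (Fin n'')).apply_symm_apply (Tg Φ)).symm
  rw [← hΛS, hback, hΦ]
  exact hall _


set_option maxHeartbeats 1000000 in -- idem
/-- **«U2c-fin» FOR THE THETA SIDE, GLOBAL-INTERTWINER FORM: A SURVIVING INDEX IS A GRAM MATRIX OF THE LINE MODEL.**  If the `S`-th Fourier coefficient of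
some doubled line theta lift is non-zero at some `h ∈ H(𝔸)` (moved to `1` by ★ `fourierCoeffDelta_thetaLift_eq_at_one`), then `βloc = a • σ(v x) ⊗ v x` for
some model vector `x` — the contrapositive of `fourierCoeffDelta_thetaLift_eq_zero_of_forall_lineGram_ne`.  Downstream, at `R = L ⊗ L⁺_v` with `βloc = ι_v b • σ(u) ⊗ u`
(`u` unimodular), ★ `eq_mul_conj_mul_self_of_smul_vecMulVec_eq` + ★ `locF_eq_of_eq_mul_conjLocal` read it as the line-class letter of ★ p862803's `hfin₂`.
[cite: KudlaRallis1994, §3] [cite: Rallis1984, §4] [cite: Weil1964, Chap. III n° 41 Thm 6 p. 193] [cite: Liu2021, Def. 4.11–4.12; App. B Prop. B.8 p. 104] -/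
theorem exists_lineGram_of_fourierCoeffDelta_thetaLift_ne_zero_of_finLineModel_conj
    (Tg : ↥(piSchwartzBruhat (Fp L) (Fin n'')) ≃ₗ[ℂ] ↥(piSchwartzBruhat (Fp L) (Fin n'')))
    (hκ : ∀ (z : Z) (Φinf : 𝓢((Fin n'' → mixedSpace (Fp L)), ℂ)) (φ : FinSB (Fp L) (Fin n'')),
      Tg (pairRep (Fp L) L (IsCMField.complexConj L) (n + n) 1 e₁ (Matrix.diagonal (dD L e dV hdV dW hdW)) (JW (Fp L) L a')
          (chiSplittingLine L e₁ (dD L e dV hdV dW hdW) (dD_conj L e dV hdV dW hdW) (dD_ne_zero L e dV hdV dW hdW hdV0 hdW0)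
            (toHeckeCharacter L lam) (isUnitary_toHeckeCharacter L lam)
            ((isOscillatorChar_toHeckeCharacter_iff lam).mpr hlam) (TW (Fp L) a')
            (isUnit_det_TW (Fp L) a') (JW (Fp L) L a') (JW_eq (Fp L) L a'))
          (toDiagA L e dV hdV dW hdW ((ι z : unipDelta L e dV hdV dW hdW) : HA L e dV hdV dW hdW), 1)
          (Tg.symm (piSchwartzBruhatEquiv (Fp L) (Fin n'') (Φinf ⊗ₜ[ℂ] φ)))) =
        piSchwartzBruhatEquiv (Fp L) (Fin n'') (Φinf ⊗ₜ[ℂ] ρf z φ))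
    (Φ : piSchwartzBruhat (Fp L) (Fin n'')) (h : HA L e dV hdV dW hdW)
    (hne : fourierCoeffDelta L e dV hdV dW hdW νN βw S (doubledLineThetaLift L e dV hdV dW hdW e₁ hdV0 hdW0 lam hlam a' hρ μW Φ fw) h ≠ 0) :
    ∃ x, a • Matrix.vecMulVec (⇑σ ∘ v x) (v x) = βloc := by
  by_contra hoff
  push Not at hoff
  apply hne
  rw [fourierCoeffDelta_thetaLift_eq_at_one]
  exact fourierCoeffDelta_thetaLift_eq_zero_of_forall_lineGram_ne L e dV hdV dW hdW e₁ hdV0 hdW0 lam hlam a' hρ μW fw νN hβ hβtop S Bl hBl P hPB cfS hcf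
    σ hσ hσF π hπ ψ hψ ρf b hb a ha v hu hρm βloc hherm χ hχ ι hχS Tg hκ hoff _

end Summit.HodgeConjecture.HodgeConjecture.Cruxes.HLiu418.K2LiuFirstTermLineLiftRankOneRowModelConj

end
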